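import Summits.HodgeConjecture.CorCM.GaloisQuaternionCyclicLift
import Mathlib.GroupTheory.SpecificGroups.Quaternion
import HarnessLib

/-!
# The quaternion–cyclic certificate lift with the balanced set given as a LIST, and `Q₃₂ × C_p ↪ Gal(K/ℚ)` through `c` with
# `C_p` normal ⟹ BAD for `p = 23` (NEW prime: `Q₈ × C₂₃` is GOOD) and `p = 19`

COR-CM (cell `pub-hodgecm2`), binder seat b04 (gen 40), count-neutral own lane «Galois-CM-type classification» (blanket
`CorCM/Galois*`).  KERNEL ONLY: theorems (`decide +kernel` certificates); no definition, no named fact, no `sorry`.  `HC_CM` is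
neither used nor claimed.

THE TWO-SHEET NORM FORMAT (seat notes A7-JUNCTION gen 40).  On `G = Q_{4m} × C_p` (`c = (aᵐ, 1)`) write a CM set `T` as
`Θ̄ = U₀ + x̄ U₁` in `R = ℤ[G]/(c + 1)`, `U_s = Σ_{i<m, j<p} ε_s(i,j) XⁱYʲ` (`ε = ±1`, `X = a`, `Y` a generator of `C_p`, `x̄ X = X⁻¹ x̄`,
`x̄² = −1`).  If the two-sheet norm `N = U₀U₀^σ + U₁U₁^σ` (`σ : X ↦ X⁻¹`) vanishes modulo `Φ_p(Y)` — i.e. `(1 − Y)·N = 0` in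
`ℤ[X,Y]/(Xᵐ + 1, Yᵖ − 1)` — then the right annihilator `τ(Θ̄)(1 − Y)` (`τ : Y ↦ Y⁻¹`) of `Θ̄^*` is, read back on `G`, the signed set
`𝟙_D − 𝟙_{cD}` with **`D = ψT ∖ ψ′T`**, `ψ(q, yᵛ) = (q, y⁻ᵛ)`, `ψ′(q, yᵛ) = (q, y¹⁻ᵛ)`: so `D` is BALANCED (`2·#{x ∈ D : xg ∈ T} = #D` for
all `g`), moved by `c`, and balanced over `C_p` (the number of descents of each cyclic row equals its number of ascents) — exactly
gen 39's lift format (`CorCM/GaloisQuaternionCyclicLift`, `CorCM/GaloisBalancedCertificateLift`), with `#D` = the total number of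
descents of the `4m` cyclic rows of `T` (small).  §1 restates the lift with `T` a decidable PREDICATE (one numeral, bit
`idx(aⁱ, v) = i·p + v`, `idx(x aⁱ, v) = (2m + i)·p + v`) and `D` a LIST (no `Finset` literal, no filter over `G`): the kernel cost is
`|G|·#D` memberships.  §2–§3: the Gauss-alphabet words of A7-JUNCTION gen 39 §B.11 for `Q₃₂ × C₂₃` (`λ = (1,5,2,1,2,4,1,0)`,
`μ = (2,2,1,1,1,0,1,0)`; `#D = 46`) and `Q₃₂ × C₁₉` (`λ = (2,1,6,2,1,1,1,0)`, `μ = (2,3,1,0,1,0,0,0)`; `#D = 38`).  `p = 23` is NEW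
(`ord₂₃ 2 = 11` is odd, so `Q₈ × C₂₃` is GOOD by `CorCM/GaloisQuaternionCyclicPrimeOddOrder`; no Gauss-alphabet word exists on `Q₁₆ × C₂₃`).

References: Shimura (1998), §6.2 Thm. 3, §8.2 Prop. 26 [cite: Shimura1998]; Gordon (1999), Thm. 6.4, §9.3
[cite: Gordon1999HodgeAVSurvey].
-/

noncomputable section

open CategoryTheory CategoryTheory.Limits NumberField
open scoped BigOperators

namespace Summit.HodgeConjecture.CorCM.GaloisModels

open Literature.NumberTheory.ComplexMultiplication
open Literature.AlgebraicGeometry.Motives (AbelianVariety CMType)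
open Literature.AlgebraicGeometry.HodgeTheory
open Literature.AlgebraicGeometry.ComplexMultiplication (IsCMTypeRealisation)
open Literature.AlgebraicGeometry.Pohlmann1968
open Literature.Barriers.HodgeConjecture (divisorClassesSpan)
open Summit.HodgeConjecture.CorCM.GaloisRank
open QuaternionGroup

variable {K : Type} [Field K] [NumberField K] [IsCMField K]

/-! ## §1 List-encoded balanced sets -/

/-- **`Q_{4m} × C_p ↪ Gal(K/ℚ)` through `c` with `C_p` normal + a balanced certificate (CM set a PREDICATE, balanced set a LIST)
⟹ BAD.**  Hypotheses as in `exists_simple_degenerate_of_quaternion_cyclic_certificate`, with `D` a duplicate-free list: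
`2·#{x ∈ D : P(xg)} = #D` for all `g`, some `x ∈ D` with `c x ∉ D`, and the first coordinates of `D` and of `cD` agree as multisets.
[cite: Shimura1998, §6.2 Thm. 3 and §8.2 Prop. 26] [cite: Gordon1999HodgeAVSurvey, Thm. 6.4 and §9.3] -/
theorem exists_simple_degenerate_of_quaternion_cyclic_certificate_list [IsGalois ℚ K] {m p : ℕ} [NeZero m] [NeZero p]
    (hm : 2 ≤ m) (hp : Odd p) (hp1 : p ≠ 1) (hcop : Nat.Coprime (4 * m) p) {A X u : K ≃ₐ[ℚ] K} (hA : orderOf A = 2 * m)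
    (hX : X * X = A ^ m) (hXA : X * A * X⁻¹ = A⁻¹) (hc : A ^ m = (IsCMField.complexConj K).restrictScalars ℚ)
    (hu : orderOf u = p) (hAu : A * u = u * A) (hXu : X * u = u * X) (hnorm : (Subgroup.zpowers u).Normal)
    (P : QuaternionGroup m × Multiplicative (ZMod p) → Prop) [DecidablePred P]
    (D : List (QuaternionGroup m × Multiplicative (ZMod p)))
    (hcm₁ : ∀ x, P x ↔ ¬ P (((a m, 1) : QuaternionGroup m × Multiplicative (ZMod p)) * x))
    (hprim₁ : ∀ v : QuaternionGroup m × Multiplicative (ZMod p), v ≠ 1 → ∃ w, ¬ (P w ↔ P (v * w)))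
    (hnodup : D.Nodup)
    (hbalL : ∀ g : QuaternionGroup m × Multiplicative (ZMod p), 2 * (D.filter fun x => P (x * g)).length = D.length)
    (hmovL : ∃ x ∈ D, ((a m, 1) : QuaternionGroup m × Multiplicative (ZMod p)) * x ∉ D)
    (hsymL : ((D.map Prod.fst : List (QuaternionGroup m)) : Multiset (QuaternionGroup m)) =
      ((D.map fun x => (((a m, 1) : QuaternionGroup m × Multiplicative (ZMod p)) * x).1 :
        List (QuaternionGroup m)) : Multiset (QuaternionGroup m))) :
    ∃ (Φ : CMType K) (φ₀ : K →+* ℂ) (A : AbelianVariety ℂ) (ι : 𝓞 K →+* End A)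
      (θ : K →+* Module.End ℂ (complexBetti A.X 1)),
      IsPrimitive (ℂ ≃+* ℂ) Φ.1 φ₀ ∧ ¬ IsNondegenerate Φ ∧ IsCMTypeRealisation Φ A ι θ ∧ A.IsSimple ∧
      A.dim = Module.finrank ℚ K / 2 ∧
      ∃ n p : ℕ, ∃ x : complexBetti (⨁ fun _ : Fin n => A).X (2 * p), IsRationalClass x ∧
        IsOfHodgeType (⨁ fun _ : Fin n => A).dim (⨁ fun _ : Fin n => A).X (2 * p) p p x ∧
        x ∉ divisorClassesSpan (⨁ fun _ : Fin n => A).X (⨁ fun _ : Fin n => A).dim p := by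
  classical
  set D₁ : Finset (QuaternionGroup m × Multiplicative (ZMod p)) :=
    ⟨(D : Multiset (QuaternionGroup m × Multiplicative (ZMod p))), Multiset.coe_nodup.2 hnodup⟩ with hD₁
  have hD₁val : D₁.val = (D : Multiset (QuaternionGroup m × Multiplicative (ZMod p))) := rfl
  refine exists_simple_degenerate_of_quaternion_cyclic_certificate hm hp hp1 hcop hA hX hXA hc hu hAu hXu hnorm
    (Finset.univ.filter P) (fun x => ?_) (fun v hv => ?_) D₁ (fun g => ?_) ?_ ?_
  · simp only [Finset.mem_filter, Finset.mem_univ, true_and]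
    exact hcm₁ x
  · obtain ⟨w, hw⟩ := hprim₁ v hv
    exact ⟨w, by simpa only [Finset.mem_filter, Finset.mem_univ, true_and] using hw⟩
  · have h1 : (D₁.filter fun x => x * g ∈ Finset.univ.filter P).card = (D.filter fun x => P (x * g)).length := by
      rw [Finset.card_def, Finset.filter_val, hD₁val, Multiset.filter_congr (q := fun x => P (x * g)) (fun x _ => by
        simp only [Finset.mem_filter, Finset.mem_univ, true_and])]
      simp only [Multiset.filter_coe, Multiset.coe_card]
    have h2 : D₁.card = D.length := by rw [Finset.card_def, hD₁val, Multiset.coe_card]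
    rw [h1, h2]
    exact hbalL g
  · obtain ⟨x, hx, hcx⟩ := hmovL
    refine ⟨x, ?_, ?_⟩
    · rw [← Finset.mem_val, hD₁val]; exact Multiset.mem_coe.2 hx
    · rw [← Finset.mem_val, hD₁val]; exact fun h => hcx (Multiset.mem_coe.1 h)
  · rw [hD₁val, Multiset.map_map, Multiset.map_coe, Multiset.map_coe]
    exact hsymL

/-- **The same with the balance condition SPLIT along a colouring `κ : G → Fin k`** (one kernel run per colour: for `|G|·#D` beyond
≈ `10⁵` memberships a single `decide +kernel` exceeds the kernel's memory). [cite: Shimura1998, §6.2 Thm. 3 and §8.2 Prop. 26]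
[cite: Gordon1999HodgeAVSurvey, Thm. 6.4 and §9.3] -/
theorem exists_simple_degenerate_of_quaternion_cyclic_certificate_list_split [IsGalois ℚ K] {m p : ℕ} [NeZero m] [NeZero p]
    (hm : 2 ≤ m) (hp : Odd p) (hp1 : p ≠ 1) (hcop : Nat.Coprime (4 * m) p) {A X u : K ≃ₐ[ℚ] K} (hA : orderOf A = 2 * m)
    (hX : X * X = A ^ m) (hXA : X * A * X⁻¹ = A⁻¹) (hc : A ^ m = (IsCMField.complexConj K).restrictScalars ℚ)
    (hu : orderOf u = p) (hAu : A * u = u * A) (hXu : X * u = u * X) (hnorm : (Subgroup.zpowers u).Normal)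
    (P : QuaternionGroup m × Multiplicative (ZMod p) → Prop) [DecidablePred P]
    (D : List (QuaternionGroup m × Multiplicative (ZMod p))) {k : ℕ} (κ : QuaternionGroup m × Multiplicative (ZMod p) → Fin k)
    (hcm₁ : ∀ x, P x ↔ ¬ P (((a m, 1) : QuaternionGroup m × Multiplicative (ZMod p)) * x))
    (hprim₁ : ∀ v : QuaternionGroup m × Multiplicative (ZMod p), v ≠ 1 → ∃ w, ¬ (P w ↔ P (v * w)))
    (hnodup : D.Nodup)
    (hbalS : ∀ i : Fin k, ∀ g : QuaternionGroup m × Multiplicative (ZMod p), κ g = i →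
      2 * (D.filter fun x => P (x * g)).length = D.length)
    (hmovL : ∃ x ∈ D, ((a m, 1) : QuaternionGroup m × Multiplicative (ZMod p)) * x ∉ D)
    (hsymL : ((D.map Prod.fst : List (QuaternionGroup m)) : Multiset (QuaternionGroup m)) =
      ((D.map fun x => (((a m, 1) : QuaternionGroup m × Multiplicative (ZMod p)) * x).1 :
        List (QuaternionGroup m)) : Multiset (QuaternionGroup m))) :
    ∃ (Φ : CMType K) (φ₀ : K →+* ℂ) (A : AbelianVariety ℂ) (ι : 𝓞 K →+* End A)
      (θ : K →+* Module.End ℂ (complexBetti A.X 1)),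
      IsPrimitive (ℂ ≃+* ℂ) Φ.1 φ₀ ∧ ¬ IsNondegenerate Φ ∧ IsCMTypeRealisation Φ A ι θ ∧ A.IsSimple ∧
      A.dim = Module.finrank ℚ K / 2 ∧
      ∃ n p : ℕ, ∃ x : complexBetti (⨁ fun _ : Fin n => A).X (2 * p), IsRationalClass x ∧
        IsOfHodgeType (⨁ fun _ : Fin n => A).dim (⨁ fun _ : Fin n => A).X (2 * p) p p x ∧
        x ∉ divisorClassesSpan (⨁ fun _ : Fin n => A).X (⨁ fun _ : Fin n => A).dim p :=
  exists_simple_degenerate_of_quaternion_cyclic_certificate_list hm hp hp1 hcop hA hX hXA hc hu hAu hXu hnorm P D hcm₁ hprim₁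
    hnodup (fun g => hbalS (κ g) g rfl) hmovL hsymL

/-! ## `Q₃₂ × C_{23}` -/

set_option maxRecDepth 32000 in
/-- **`Q₃₂ × C_{23} ↪ Gal(K/ℚ)` through `c`, `C_{23}` normal ⟹ BAD**: `ord A = 16`, `X² = A⁸ = c`, `XAX⁻¹ = A⁻¹`, `ord u = 23`,
`[A,u] = [X,u] = 1`, `⟨u⟩ ◁ Gal`.  The two-sheet type of the seat's Gauss-alphabet word (A7-JUNCTION gen 39 §B.11), numeral-encoded;
its shifted difference `D = ψT ∖ ψ'T` (46 elements, listed) is balanced, moved by `c`, balanced over `C_{23}`.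
[cite: Shimura1998, §6.2 Thm. 3 and §8.2 Prop. 26] [cite: Gordon1999HodgeAVSurvey, Thm. 6.4 and §9.3] -/
theorem exists_simple_degenerate_of_quaternionThirtyTwo_cyclic23_subgroup [IsGalois ℚ K] {A X u : K ≃ₐ[ℚ] K}
    (hA : orderOf A = 16) (hX : X * X = A ^ 8) (hXA : X * A * X⁻¹ = A⁻¹)
    (hc : A ^ 8 = (IsCMField.complexConj K).restrictScalars ℚ) (hu : orderOf u = 23) (hAu : A * u = u * A)
    (hXu : X * u = u * X) (hnorm : (Subgroup.zpowers u).Normal) :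
    ∃ (Φ : CMType K) (φ₀ : K →+* ℂ) (A : AbelianVariety ℂ) (ι : 𝓞 K →+* End A)
      (θ : K →+* Module.End ℂ (complexBetti A.X 1)),
      IsPrimitive (ℂ ≃+* ℂ) Φ.1 φ₀ ∧ ¬ IsNondegenerate Φ ∧ IsCMTypeRealisation Φ A ι θ ∧ A.IsSimple ∧
      A.dim = Module.finrank ℚ K / 2 ∧
      ∃ n p : ℕ, ∃ x : complexBetti (⨁ fun _ : Fin n => A).X (2 * p), IsRationalClass x ∧
        IsOfHodgeType (⨁ fun _ : Fin n => A).dim (⨁ fun _ : Fin n => A).X (2 * p) p p x ∧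
        x ∉ divisorClassesSpan (⨁ fun _ : Fin n => A).X (⨁ fun _ : Fin n => A).dim p :=
  exists_simple_degenerate_of_quaternion_cyclic_certificate_list (m := 8) (p := 23) (by norm_num) (by decide) (by decide)
    (by decide) hA hX hXA hc hu hAu hXu hnorm
    (fun g => 361473786714646702758019575895690142895668728025520305753343252075822758796385200510193003583319971145250272784659527560546316605737485990211014543516401854231420724911111119713977454614696380307245598673885595219278168065 / 2 ^ ((match g.1 with | a i => i.val | xa i => 16 + i.val) * 23 + (Multiplicative.toAdd g.2).val) % 2 = 1)
    [(a 0, Multiplicative.ofAdd 0), (a 1, Multiplicative.ofAdd 0), (a 1, Multiplicative.ofAdd 6),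
      (a 1, Multiplicative.ofAdd 8), (a 1, Multiplicative.ofAdd 12), (a 1, Multiplicative.ofAdd 16),
      (a 1, Multiplicative.ofAdd 18), (a 2, Multiplicative.ofAdd 1), (a 3, Multiplicative.ofAdd 0),
      (a 4, Multiplicative.ofAdd 1), (a 5, Multiplicative.ofAdd 5), (a 5, Multiplicative.ofAdd 7),
      (a 5, Multiplicative.ofAdd 10), (a 5, Multiplicative.ofAdd 14), (a 5, Multiplicative.ofAdd 17),
      (a 5, Multiplicative.ofAdd 19), (a 6, Multiplicative.ofAdd 0), (a 8, Multiplicative.ofAdd 1),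
      (a 9, Multiplicative.ofAdd 5), (a 9, Multiplicative.ofAdd 7), (a 9, Multiplicative.ofAdd 10),
      (a 9, Multiplicative.ofAdd 14), (a 9, Multiplicative.ofAdd 17), (a 9, Multiplicative.ofAdd 19),
      (a 10, Multiplicative.ofAdd 0), (a 11, Multiplicative.ofAdd 1), (a 12, Multiplicative.ofAdd 0),
      (a 13, Multiplicative.ofAdd 1), (a 13, Multiplicative.ofAdd 6), (a 13, Multiplicative.ofAdd 8),
      (a 13, Multiplicative.ofAdd 12), (a 13, Multiplicative.ofAdd 16), (a 13, Multiplicative.ofAdd 18),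
      (a 14, Multiplicative.ofAdd 1), (xa 0, Multiplicative.ofAdd 1), (xa 1, Multiplicative.ofAdd 1),
      (xa 2, Multiplicative.ofAdd 0), (xa 3, Multiplicative.ofAdd 0), (xa 4, Multiplicative.ofAdd 0),
      (xa 6, Multiplicative.ofAdd 0), (xa 8, Multiplicative.ofAdd 0), (xa 9, Multiplicative.ofAdd 0),
      (xa 10, Multiplicative.ofAdd 1), (xa 11, Multiplicative.ofAdd 1), (xa 12, Multiplicative.ofAdd 1),
      (xa 14, Multiplicative.ofAdd 1)]
    (by decide +kernel) (by decide +kernel) (by decide +kernel) (by decide +kernel) (by decide +kernel) (by decide +kernel)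

/-! ## `Q₃₂ × C_{19}` -/

set_option maxRecDepth 32000 in
/-- **`Q₃₂ × C_{19} ↪ Gal(K/ℚ)` through `c`, `C_{19}` normal ⟹ BAD**: `ord A = 16`, `X² = A⁸ = c`, `XAX⁻¹ = A⁻¹`, `ord u = 19`,
`[A,u] = [X,u] = 1`, `⟨u⟩ ◁ Gal`.  The two-sheet type of the seat's Gauss-alphabet word (A7-JUNCTION gen 39 §B.11), numeral-encoded;
its shifted difference `D = ψT ∖ ψ'T` (38 elements, listed) is balanced, moved by `c`, balanced over `C_{19}`.
[cite: Shimura1998, §6.2 Thm. 3 and §8.2 Prop. 26] [cite: Gordon1999HodgeAVSurvey, Thm. 6.4 and §9.3] -/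
theorem exists_simple_degenerate_of_quaternionThirtyTwo_cyclic19_subgroup [IsGalois ℚ K] {A X u : K ≃ₐ[ℚ] K}
    (hA : orderOf A = 16) (hX : X * X = A ^ 8) (hXA : X * A * X⁻¹ = A⁻¹)
    (hc : A ^ 8 = (IsCMField.complexConj K).restrictScalars ℚ) (hu : orderOf u = 19) (hAu : A * u = u * A)
    (hXu : X * u = u * X) (hnorm : (Subgroup.zpowers u).Normal) :
    ∃ (Φ : CMType K) (φ₀ : K →+* ℂ) (A : AbelianVariety ℂ) (ι : 𝓞 K →+* End A)
      (θ : K →+* Module.End ℂ (complexBetti A.X 1)),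
      IsPrimitive (ℂ ≃+* ℂ) Φ.1 φ₀ ∧ ¬ IsNondegenerate Φ ∧ IsCMTypeRealisation Φ A ι θ ∧ A.IsSimple ∧
      A.dim = Module.finrank ℚ K / 2 ∧
      ∃ n p : ℕ, ∃ x : complexBetti (⨁ fun _ : Fin n => A).X (2 * p), IsRationalClass x ∧
        IsOfHodgeType (⨁ fun _ : Fin n => A).dim (⨁ fun _ : Fin n => A).X (2 * p) p p x ∧
        x ∉ divisorClassesSpan (⨁ fun _ : Fin n => A).X (⨁ fun _ : Fin n => A).dim p :=
  exists_simple_degenerate_of_quaternion_cyclic_certificate_list (m := 8) (p := 19) (by norm_num) (by decide) (by decide)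
    (by decide) hA hX hXA hc hu hAu hXu hnorm
    (fun g => 1062275985633534197379162353999329224330502211173562317339191808911877220520431813823954895414997347526674460104011305289181485951450218971046788367600839610261958720954161981929029630 / 2 ^ ((match g.1 with | a i => i.val | xa i => 16 + i.val) * 19 + (Multiplicative.toAdd g.2).val) % 2 = 1)
    [(a 0, Multiplicative.ofAdd 1), (a 1, Multiplicative.ofAdd 0), (a 2, Multiplicative.ofAdd 2),
      (a 2, Multiplicative.ofAdd 8), (a 2, Multiplicative.ofAdd 10), (a 2, Multiplicative.ofAdd 12),
      (a 2, Multiplicative.ofAdd 18), (a 3, Multiplicative.ofAdd 1), (a 4, Multiplicative.ofAdd 0),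
      (a 5, Multiplicative.ofAdd 0), (a 6, Multiplicative.ofAdd 0), (a 8, Multiplicative.ofAdd 0),
      (a 9, Multiplicative.ofAdd 1), (a 10, Multiplicative.ofAdd 0), (a 10, Multiplicative.ofAdd 4),
      (a 10, Multiplicative.ofAdd 9), (a 10, Multiplicative.ofAdd 11), (a 10, Multiplicative.ofAdd 16),
      (a 11, Multiplicative.ofAdd 0), (a 12, Multiplicative.ofAdd 1), (a 13, Multiplicative.ofAdd 1),
      (a 14, Multiplicative.ofAdd 1), (xa 0, Multiplicative.ofAdd 1), (xa 1, Multiplicative.ofAdd 1),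
      (xa 1, Multiplicative.ofAdd 4), (xa 1, Multiplicative.ofAdd 9), (xa 1, Multiplicative.ofAdd 11),
      (xa 1, Multiplicative.ofAdd 16), (xa 2, Multiplicative.ofAdd 0), (xa 4, Multiplicative.ofAdd 0),
      (xa 8, Multiplicative.ofAdd 0), (xa 9, Multiplicative.ofAdd 2), (xa 9, Multiplicative.ofAdd 8),
      (xa 9, Multiplicative.ofAdd 10), (xa 9, Multiplicative.ofAdd 12), (xa 9, Multiplicative.ofAdd 18),
      (xa 10, Multiplicative.ofAdd 1), (xa 12, Multiplicative.ofAdd 1)]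
    (by decide +kernel) (by decide +kernel) (by decide +kernel) (by decide +kernel) (by decide +kernel) (by decide +kernel)

end Summit.HodgeConjecture.CorCM.GaloisModels

end
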